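import Literature.Probability.RandomPlanarGeometry.SLERestrictionBoundary
import HarnessLib

/-!
# The localised restriction martingale of [LSW] Prop. 5.2/5.3 (`κ = 8/3`) is a martingale

For a nonempty `*`-hull `A` and `n ∈ ℕ`, the stopped process

  `Mⁿ_t = Ỹ_{t ∧ Tₙ}`,   `Ỹ_t = (D̂ⁿ⁺¹_t)^{5/8}`   (`= Φ'_{A_t - W_t}(0)^{5/8}` up to `Tₙ`)

of `SLERestrictionProcesses` is a bounded `𝓕`-martingale of the SLE_{8/3} driving Brownian motion
(`martingale_locMart`). This is the local-martingale content of [LSW] Prop. 5.2/5.3 — there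
obtained by Itô's formula for the random conformal maps `h_t`; here by **conditional increments**:
over a partition of `[s, t]` of mesh `h`, the increment of `Mⁿ` over a cell `[u, u + h]` splits into
the conditional one-step term, of expectation `O(h^{3/2})` (`abs_integral_mul_sub_le`, the
deterministic hull expansion of `StarHullOneStep*` integrated against a frozen past), and a
boundary term supported on `{u < Tₙ < u + h}`, small by continuity of `Φ'` along the path
(`abs_stopped_sub_DFn_rpow_le`) off an event of small driver oscillation whose probability is
`O(h²)`; letting the mesh and then the oscillation threshold go to `0` gives
`E[𝟙_S (Mⁿ_t - Mⁿ_s)] = 0` for `S ∈ 𝓕_s`.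

## References

* G. F. Lawler, O. Schramm, W. Werner, *Conformal restriction: the chordal case* (2003),
  Prop. 5.2, Prop. 5.3 [LawlerSchrammWerner2003Restriction].
-/

noncomputable section

open Set Filter Metric Function MeasureTheory ProbabilityTheory
open _root_.Complex _root_.Topology
open Literature.Probability.Process (brownian preWienerMeasure runSup)
open scoped NNReal

namespace Literature.Probability.RandomPlanarGeometry

open Loewner PathOps

section LocMart

variable {A : Set ℂ} (hA : IsStarHull A) (hne : A.Nonempty) (n : ℕ)

/-- `Ỹ_t = (D̂ⁿ⁺¹_t)^{5/8}`. [folklore] -/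
def Ytil (t : ℝ≥0) (ω : ℝ≥0 → ℝ) : ℝ := Dhatp hA hne (n + 1) t ω ^ (5 / 8 : ℝ)

/-- **The localised restriction martingale** `Mⁿ_t = Ỹ_{t ∧ Tₙ}`. [cite: LawlerSchrammWerner2003Restriction, Prop. 5.2] -/
def locMart : ℝ≥0 → (ℝ≥0 → ℝ) → ℝ := stoppedProcess (Ytil hA hne n) (locTime hA hne n)

variable {hA hne n}

/-- `0 ≤ Ỹ ≤ 1`. [folklore] -/
theorem Ytil_mem_Icc (t : ℝ≥0) (ω : ℝ≥0 → ℝ) : Ytil hA hne n t ω ∈ Icc (0 : ℝ) 1 := by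
  obtain ⟨h0, h1⟩ := DhatFn_mem_Icc (hA := hA) (hne := hne) (n + 1) t (brownianCPath ω)
  exact ⟨Real.rpow_nonneg h0 _, Real.rpow_le_one h0 h1 (by norm_num)⟩

/-- `0 ≤ Mⁿ ≤ 1`. [folklore] -/
theorem locMart_mem_Icc (t : ℝ≥0) (ω : ℝ≥0 → ℝ) : locMart hA hne n t ω ∈ Icc (0 : ℝ) 1 :=
  Ytil_mem_Icc _ _

/-- `Ỹ` has continuous paths. [folklore] -/
theorem continuous_Ytil (ω : ℝ≥0 → ℝ) : Continuous fun t ↦ Ytil hA hne n t ω :=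
  (continuous_Rp_Dhatp (hA := hA) (hne := hne) (n + 1) ω).2.rpow_const fun _ ↦ Or.inr (by norm_num)

/-- `Ỹ` is adapted. [folklore] -/
theorem adapted_Ytil : Adapted brownianFiltration (Ytil hA hne n) := fun t ↦
  (adapted_Dhatp (hA := hA) (hne := hne) (n + 1) t).pow_const _

/-- **`Mⁿ` is strongly adapted** (stopped continuous adapted process). [folklore] -/
theorem stronglyAdapted_locMart : StronglyAdapted brownianFiltration (locMart hA hne n) :=
  (adapted_Ytil.stronglyAdapted).stoppedProcess continuous_Ytil (isStoppingTime_locTime n)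

/-- `Mⁿ_t` is integrable. [folklore] -/
theorem integrable_locMart (t : ℝ≥0) : Integrable (locMart hA hne n t) preWienerMeasure := by
  haveI := isProbabilityMeasure_preWienerMeasure'
  refine (integrable_const (1 : ℝ)).mono' ((stronglyAdapted_locMart t).mono (brownianFiltration.le t)).aestronglyMeasurable
    (Eventually.of_forall fun ω ↦ ?_)
  rw [Real.norm_eq_abs, abs_of_nonneg (locMart_mem_Icc t ω).1]
  exact (locMart_mem_Icc t ω).2

/-! ### The cell decomposition -/

/-- On `{Tₙ ≥ u + h}` there is no boundary term: `Mⁿ_{u+h} = Ŷ_{u+h}`. [folklore] -/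
theorem locMart_eq_DFn_rpow_of_le {u h : ℝ≥0} {ω : ℝ≥0 → ℝ} (hle : ((u + h : ℝ≥0) : WithTop ℝ≥0) ≤ locTime hA hne n ω)
    (hT0 : (0 : WithTop ℝ≥0) < locTime hA hne n ω) :
    locMart hA hne n (u + h) ω = DFn A (u + h) (brownianCPath ω) ^ (5 / 8 : ℝ) := by
  rw [locMart, stoppedProcess, min_eq_left hle, Process.untopA_coe, Ytil]
  obtain ⟨halive, -, hDeq, -, -⟩ := controlled_of_le_locTime hle hT0
  rw [hDeq, (DFn_eq (A := A) (u + h) (brownianCPath ω)).1 halive]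

/-- **The cell decomposition**: with `g = 𝟙_S 𝟙{u < Tₙ}`,
`𝟙_S (Mⁿ_{u+h} - Mⁿ_u) = g · (Ŷ_{u+h} - Y_u) + g · (Mⁿ_{u+h} - Ŷ_{u+h})`, `Y_u = Φ'_{A_u - W_u}(0)^{5/8}`.
[folklore] -/
theorem indicator_mul_locMart_sub (S : Set (ℝ≥0 → ℝ)) (u h : ℝ≥0) (ω : ℝ≥0 → ℝ) :
    S.indicator (fun _ ↦ (1 : ℝ)) ω * (locMart hA hne n (u + h) ω - locMart hA hne n u ω) =
      (S.indicator (fun _ ↦ (1 : ℝ)) ω * {ω | (u : WithTop ℝ≥0) < locTime hA hne n ω}.indicator (fun _ ↦ (1 : ℝ)) ω) *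
          (DFn A (u + h) (brownianCPath ω) ^ (5 / 8 : ℝ) - starDeriv (slidHull (drv (brownianCPath ω)) A u) ^ (5 / 8 : ℝ)) +
        (S.indicator (fun _ ↦ (1 : ℝ)) ω * {ω | (u : WithTop ℝ≥0) < locTime hA hne n ω}.indicator (fun _ ↦ (1 : ℝ)) ω) *
          (locMart hA hne n (u + h) ω - DFn A (u + h) (brownianCPath ω) ^ (5 / 8 : ℝ)) := by
  by_cases hT : (u : WithTop ℝ≥0) < locTime hA hne n ω
  · rw [Set.indicator_of_mem (show ω ∈ {ω | (u : WithTop ℝ≥0) < locTime hA hne n ω} from hT), mul_one]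
    have hMu : locMart hA hne n u ω = starDeriv (slidHull (drv (brownianCPath ω)) A u) ^ (5 / 8 : ℝ) := by
      rw [locMart, stoppedProcess, min_eq_left hT.le, Process.untopA_coe, Ytil]
      obtain ⟨-, -, hDeq, -, -⟩ := controlled_of_lt_locTime hT
      rw [hDeq]
    rw [hMu]; ring
  · rw [Set.indicator_of_notMem (show ω ∉ {ω | (u : WithTop ℝ≥0) < locTime hA hne n ω} from hT), mul_zero, zero_mul,
      zero_mul, add_zero]
    have : locMart hA hne n (u + h) ω = locMart hA hne n u ω := by
      rw [not_lt] at hT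
      have hT' : locTime hA hne n ω ≤ ((u + h : ℝ≥0) : WithTop ℝ≥0) := hT.trans (by exact_mod_cast le_self_add)
      rw [locMart, stoppedProcess, stoppedProcess, min_eq_right hT, min_eq_right hT']
    rw [this, sub_self, mul_zero]


/-! ### The integral over one cell -/

section Cell

variable [MeasurableSpace C(ℝ≥0, ℝ)] [BorelSpace C(ℝ≥0, ℝ)]

/-- Measurability of the pieces. [folklore] -/
theorem measurable_pieces (u h : ℝ≥0) :
    Measurable (locMart hA hne n (u + h)) ∧ Measurable (locMart hA hne n u) ∧
      Measurable (fun ω ↦ DFn A (u + h) (brownianCPath ω) ^ (5 / 8 : ℝ)) ∧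
      MeasurableSet {ω | (u : WithTop ℝ≥0) < locTime hA hne n ω} ∧
      MeasurableSet {ω | locTime hA hne n ω < ((u + h : ℝ≥0) : WithTop ℝ≥0)} := by
  refine ⟨(stronglyAdapted_locMart (u + h)).measurable.mono (brownianFiltration.le _) le_rfl,
    (stronglyAdapted_locMart u).measurable.mono (brownianFiltration.le _) le_rfl,
    ((measurable_DFn hA hne (u + h)).comp measurable_brownianCPath).pow_const _,
    brownianFiltration.le u _ ((isStoppingTime_locTime n).measurableSet_gt u),
    brownianFiltration.le (u + h) _ ((isStoppingTime_locTime n).measurableSet_lt (u + h))⟩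

/-- **The cell estimate in expectation.** For `s ≤ u`, `S ∈ 𝓕_s`, a threshold `κ₀ > 0` and a small
step `h`:
`|∫_S (Mⁿ_{u+h} - Mⁿ_u)| ≤ stepC cₙ (cₙ/16) h√h + (2Δ₀)^{5/8} P(u < Tₙ < u+h) + 128 σ⁴ h²/κ₀⁴`.
[cite: LawlerSchrammWerner2003Restriction, Prop. 5.2 and Prop. 5.3] -/
theorem abs_setIntegral_cell_le {s u h : ℝ≥0} (hsu : s ≤ u) {S : Set (ℝ≥0 → ℝ)} (hS : MeasurableSet[brownianFiltration s] S)
    {κ₀ : ℝ} (hκ₀ : 0 < κ₀) (hh0 : 0 < h)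
    (hh1 : (h : ℝ) ≤ (locLevel n * (locLevel n / 16) / 4000) ^ 2 / 32)
    (hh2 : stepSize κ₀ h ≤ locLevel n * (locLevel n / 16) / 1000)
    (hh3 : (h : ℝ) ≤ (locLevel n / 16 / 4) ^ 2)
    (hh4 : (h : ℝ) ≤ (κ₀ / stepSigma / 2) ^ 2 / 2) :
    |∫ ω in S, (locMart hA hne n (u + h) ω - locMart hA hne n u ω) ∂preWienerMeasure| ≤
      stepC (locLevel n) (locLevel n / 16) * h * Real.sqrt h +
        (2 * cellErr n κ₀ h) ^ (5 / 8 : ℝ) *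
          preWienerMeasure.real {ω | (u : WithTop ℝ≥0) < locTime hA hne n ω ∧ locTime hA hne n ω < ((u + h : ℝ≥0) : WithTop ℝ≥0)} +
        128 * (h : ℝ) ^ 2 / (κ₀ / stepSigma) ^ 4 := by
  haveI := isProbabilityMeasure_preWienerMeasure'
  obtain ⟨hc0, hc1⟩ := locLevel_pos_le n
  have hσ := stepSigma_pos
  obtain ⟨hMm1, hMm0, hYhm, hEgt, hElt⟩ := measurable_pieces (hA := hA) (hne := hne) (n := n) u h
  have hSm : MeasurableSet S := brownianFiltration.le s _ hS
  set T := locTime hA hne n with hT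
  set g : (ℝ≥0 → ℝ) → ℝ := fun ω ↦ S.indicator (fun _ ↦ (1 : ℝ)) ω * {ω | (u : WithTop ℝ≥0) < T ω}.indicator (fun _ ↦ (1 : ℝ)) ω
    with hg
  set Yh : (ℝ≥0 → ℝ) → ℝ := fun ω ↦ DFn A (u + h) (brownianCPath ω) ^ (5 / 8 : ℝ) with hYh
  set Yu : (ℝ≥0 → ℝ) → ℝ := fun ω ↦ starDeriv (slidHull (drv (brownianCPath ω)) A u) ^ (5 / 8 : ℝ) with hYu
  set b : (ℝ≥0 → ℝ) → ℝ := fun ω ↦ g ω * (locMart hA hne n (u + h) ω - Yh ω) with hb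
  -- `g` is `𝓕_u`-measurable with values in `{0, 1}`
  have hgmu : Measurable[brownianFiltration u] g := by
    have h1 : Measurable[brownianFiltration u] (S.indicator fun _ ↦ (1 : ℝ)) :=
      (measurable_const (a := (1 : ℝ))).indicator (brownianFiltration.mono hsu _ hS)
    have h2 : Measurable[brownianFiltration u] ({ω | (u : WithTop ℝ≥0) < T ω}.indicator fun _ ↦ (1 : ℝ)) :=
      (measurable_const (a := (1 : ℝ))).indicator ((isStoppingTime_locTime n).measurableSet_gt u)
    exact h1.mul h2
  have hgm : Measurable g := hgmu.mono (brownianFiltration.le u) le_rfl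
  have hg01 : ∀ ω, g ω ∈ Icc (0 : ℝ) 1 := fun ω ↦ by
    rw [hg]; simp only
    by_cases h1 : ω ∈ S
    · by_cases h2 : ω ∈ {ω | (u : WithTop ℝ≥0) < T ω}
      · rw [Set.indicator_of_mem h1, Set.indicator_of_mem h2]; norm_num
      · rw [Set.indicator_of_mem h1, Set.indicator_of_notMem h2]; norm_num
    · rw [Set.indicator_of_notMem h1, zero_mul]; exact ⟨le_rfl, zero_le_one⟩
  have hgT : ∀ ω, g ω ≠ 0 → (u : WithTop ℝ≥0) < T ω := fun ω hω ↦ by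
    by_contra hnot
    exact hω (by rw [hg]; simp only; rw [Set.indicator_of_notMem (show ω ∉ {ω | (u : WithTop ℝ≥0) < T ω} from hnot), mul_zero])
  -- rewrite the set integral through the cell decomposition
  have hdec : ∀ ω, S.indicator (fun ω ↦ locMart hA hne n (u + h) ω - locMart hA hne n u ω) ω = g ω * (Yh ω - Yu ω) + b ω := fun ω ↦ by
    have := indicator_mul_locMart_sub (hA := hA) (hne := hne) (n := n) S u h ω
    rw [← hT] at this
    have e : S.indicator (fun ω ↦ locMart hA hne n (u + h) ω - locMart hA hne n u ω) ω =
        S.indicator (fun _ ↦ (1 : ℝ)) ω * (locMart hA hne n (u + h) ω - locMart hA hne n u ω) := by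
      by_cases hω : ω ∈ S <;> simp [hω]
    rw [e, this]
  -- integrability (everything is bounded and measurable)
  have hbdd : ∀ {f : (ℝ≥0 → ℝ) → ℝ}, Measurable f → (∀ ω, |f ω| ≤ 2) → Integrable f preWienerMeasure := fun hf hb ↦
    (integrable_const (2 : ℝ)).mono' hf.aestronglyMeasurable (Eventually.of_forall fun ω ↦ by rw [Real.norm_eq_abs]; exact hb ω)
  have hg1 : ∀ ω, |g ω| ≤ 1 := fun ω ↦ by rw [abs_of_nonneg (hg01 ω).1]; exact (hg01 ω).2
  have hYh01 : ∀ ω, Yh ω ∈ Icc (0 : ℝ) 1 := fun ω ↦ by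
    obtain ⟨-, -, h0, h1⟩ := DFn_eq (A := A) (u + h) (brownianCPath ω)
    exact ⟨Real.rpow_nonneg h0 _, Real.rpow_le_one h0 h1 (by norm_num)⟩
  have hYu01 : ∀ ω, Yu ω ∈ Icc (0 : ℝ) 1 := fun ω ↦ by
    obtain ⟨h0, h1⟩ := starDeriv_pos_le_one (slidHull (drv (brownianCPath ω)) A u)
    exact ⟨Real.rpow_nonneg h0.le _, Real.rpow_le_one h0.le h1 (by norm_num)⟩
  have hgYu_m : Measurable fun ω ↦ g ω * Yu ω := by
    have h1 : (fun ω ↦ g ω * Yu ω) = fun ω ↦ g ω * DFn A u (brownianCPath ω) ^ (5 / 8 : ℝ) := by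
      funext ω
      by_cases hg0 : g ω = 0
      · rw [hg0, zero_mul, zero_mul]
      · rw [hYu]; simp only
        obtain ⟨halive, -⟩ := controlled_of_lt_locTime (hgT ω hg0)
        rw [(DFn_eq (A := A) u (brownianCPath ω)).1 halive]
    rw [h1]
    exact hgm.mul (((measurable_DFn hA hne u).comp measurable_brownianCPath).pow_const _)
  have i1 : Integrable (fun ω ↦ g ω * (Yh ω - Yu ω)) preWienerMeasure := by
    have : (fun ω ↦ g ω * (Yh ω - Yu ω)) = fun ω ↦ g ω * Yh ω - g ω * Yu ω := by funext ω; ring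
    rw [this]
    have iA : Integrable (fun ω ↦ g ω * Yh ω) preWienerMeasure := hbdd (hgm.mul hYhm) fun ω ↦ by
      rw [abs_mul, abs_of_nonneg (hYh01 ω).1]; nlinarith [hg1 ω, (hYh01 ω).1, (hYh01 ω).2, abs_nonneg (g ω)]
    have iB : Integrable (fun ω ↦ g ω * Yu ω) preWienerMeasure := hbdd hgYu_m fun ω ↦ by
      rw [abs_mul, abs_of_nonneg (hYu01 ω).1]; nlinarith [hg1 ω, (hYu01 ω).1, (hYu01 ω).2, abs_nonneg (g ω)]
    exact iA.sub iB
  have hb_m : Measurable b := hgm.mul (hMm1.sub hYhm)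
  have hb2 : ∀ ω, |b ω| ≤ 2 := fun ω ↦ by
    rw [hb]; simp only; rw [abs_mul]
    have h1 : |locMart hA hne n (u + h) ω - Yh ω| ≤ 1 := by
      have := locMart_mem_Icc (hA := hA) (hne := hne) (n := n) (u + h) ω
      rw [abs_le]; constructor <;> linarith [this.1, this.2, (hYh01 ω).1, (hYh01 ω).2]
    nlinarith [hg1 ω, abs_nonneg (g ω), abs_nonneg (locMart hA hne n (u + h) ω - Yh ω)]
  have i2 : Integrable b preWienerMeasure := hbdd hb_m hb2
  have hsplit : ∫ ω in S, (locMart hA hne n (u + h) ω - locMart hA hne n u ω) ∂preWienerMeasure =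
      ∫ ω, g ω * (Yh ω - Yu ω) ∂preWienerMeasure + ∫ ω, b ω ∂preWienerMeasure := by
    rw [← integral_indicator hSm, ← integral_add i1 i2]
    exact integral_congr_ae (Eventually.of_forall hdec)
  rw [hsplit]
  -- (I) the conditional one-step term
  have hI : |∫ ω, g ω * (Yh ω - Yu ω) ∂preWienerMeasure| ≤ stepC (locLevel n) (locLevel n / 16) * h * Real.sqrt h := by
    refine abs_integral_mul_sub_le hA hne (by positivity) (by linarith) hc0 hc1 hh0 hh1 hgmu hg01 fun ω hω ↦ ?_
    obtain ⟨halive, -, -, hd, hm⟩ := controlled_of_lt_locTime (hgT ω hω)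
    refine ⟨halive, ?_, hd.le⟩
    rw [Set.disjoint_left]
    intro z hz hzB
    have h1 := infDist_le_dist_of_mem (x := (0 : ℂ)) hzB
    rw [dist_comm, dist_zero_right] at h1
    have h2 : ‖z‖ < 8 * (locLevel n / 16) := mem_ball_zero_iff.1 hz
    linarith
  -- (II) the boundary term
  set E : Set (ℝ≥0 → ℝ) := {ω | (u : WithTop ℝ≥0) < T ω ∧ T ω < ((u + h : ℝ≥0) : WithTop ℝ≥0)} with hE
  set Bad : Set (ℝ≥0 → ℝ) := {ω | κ₀ / stepSigma ≤ oscFn h (incr u (brownianCPath ω))} with hBad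
  have hEm : MeasurableSet E := hEgt.inter hElt
  have hBadm : MeasurableSet Bad :=
    measurableSet_le measurable_const ((measurable_oscFn h).comp ((measurable_incr u).comp measurable_brownianCPath))
  set D : ℝ := (2 * cellErr n κ₀ h) ^ (5 / 8 : ℝ) with hD
  have hΔ0 : 0 ≤ cellErr n κ₀ h := by
    rw [cellErr]; have : 0 ≤ stepSize κ₀ h := by rw [stepSize]; positivity
    positivity
  have hD0 : 0 ≤ D := Real.rpow_nonneg (by positivity) _
  have hpt : ∀ ω, |b ω| ≤ E.indicator (fun _ ↦ D) ω + Bad.indicator (fun _ ↦ (1 : ℝ)) ω := fun ω ↦ by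
    have hE0 : 0 ≤ E.indicator (fun _ ↦ D) ω := Set.indicator_nonneg (fun _ _ ↦ hD0) ω
    have hB0 : 0 ≤ Bad.indicator (fun _ ↦ (1 : ℝ)) ω := Set.indicator_nonneg (fun _ _ ↦ zero_le_one) ω
    by_cases hg0 : g ω = 0
    · rw [hb]; simp only; rw [hg0, zero_mul, abs_zero]; positivity
    have huT := hgT ω hg0
    have hT0 : (0 : WithTop ℝ≥0) < T ω := lt_of_le_of_lt bot_le huT
    have hgle : |g ω| ≤ 1 := hg1 ω
    rcases le_or_gt (((u + h : ℝ≥0) : WithTop ℝ≥0)) (T ω) with hle | hlt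
    · -- no boundary
      rw [hb]; simp only
      rw [hYh]; simp only
      rw [locMart_eq_DFn_rpow_of_le hle hT0, sub_self, mul_zero, abs_zero]; positivity
    · have hωE : ω ∈ E := ⟨huT, hlt⟩
      rw [Set.indicator_of_mem hωE]
      by_cases hbad : ω ∈ Bad
      · rw [Set.indicator_of_mem hbad]
        have := hb2 ω
        rw [hb]; simp only; rw [abs_mul]
        have h1 : |locMart hA hne n (u + h) ω - Yh ω| ≤ 1 := by
          have := locMart_mem_Icc (hA := hA) (hne := hne) (n := n) (u + h) ω
          rw [abs_le]; constructor <;> linarith [this.1, this.2, (hYh01 ω).1, (hYh01 ω).2]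
        nlinarith [abs_nonneg (g ω), abs_nonneg (locMart hA hne n (u + h) ω - Yh ω)]
      · rw [Set.indicator_of_notMem hbad, add_zero]
        have hosc : oscFn h (incr u (brownianCPath ω)) < κ₀ / stepSigma := not_le.1 hbad
        have hS' : ∀ r : ℝ≥0, r ≤ h → |drv (brownianCPath ω) (u + r) - drv (brownianCPath ω) u| ≤ κ₀ := fun r hr ↦ by
          have h1 := abs_incr_le_oscFn hr u (brownianCPath ω)
          have : drv (brownianCPath ω) (u + r) - drv (brownianCPath ω) u =
              stepSigma * ((brownianCPath ω) (u + r) - (brownianCPath ω) u) := by simp only [drv]; ring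
          rw [this, abs_mul, abs_of_pos hσ]
          have := (lt_div_iff₀' hσ).1 (lt_of_le_of_lt h1 hosc) |>.le
          nlinarith [abs_nonneg ((brownianCPath ω) (u + r) - (brownianCPath ω) u)]
        have key := abs_stopped_sub_DFn_rpow_le (hA := hA) (hne := hne) (n := n) huT hh0 hS' hh2 hh3
        rw [hb]; simp only; rw [abs_mul]
        calc |g ω| * |locMart hA hne n (u + h) ω - Yh ω| ≤ 1 * D := mul_le_mul hgle key (abs_nonneg _) zero_le_one
          _ = D := one_mul _
  have hII : |∫ ω, b ω ∂preWienerMeasure| ≤ D * preWienerMeasure.real E + 128 * (h : ℝ) ^ 2 / (κ₀ / stepSigma) ^ 4 := by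
    have iE : Integrable (E.indicator fun _ ↦ D) preWienerMeasure := (integrable_const D).indicator hEm
    have iB : Integrable (Bad.indicator fun _ ↦ (1 : ℝ)) preWienerMeasure := (integrable_const (1 : ℝ)).indicator hBadm
    calc |∫ ω, b ω ∂preWienerMeasure| ≤ ∫ ω, |b ω| ∂preWienerMeasure := abs_integral_le_integral_abs
      _ ≤ ∫ ω, (E.indicator (fun _ ↦ D) ω + Bad.indicator (fun _ ↦ (1 : ℝ)) ω) ∂preWienerMeasure :=
          integral_mono i2.abs (iE.add iB) hpt
      _ = D * preWienerMeasure.real E + preWienerMeasure.real Bad := by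
          rw [integral_add iE iB, integral_indicator_const _ hEm, integral_indicator_const _ hBadm]
          simp [smul_eq_mul, mul_comm]
      _ ≤ D * preWienerMeasure.real E + 128 * (h : ℝ) ^ 2 / (κ₀ / stepSigma) ^ 4 := by
          have := measureReal_oscFn_incr_ge_le h u (by positivity : 0 < κ₀ / stepSigma) hh4
          linarith
  calc |∫ ω, g ω * (Yh ω - Yu ω) ∂preWienerMeasure + ∫ ω, b ω ∂preWienerMeasure|
      ≤ |∫ ω, g ω * (Yh ω - Yu ω) ∂preWienerMeasure| + |∫ ω, b ω ∂preWienerMeasure| := abs_add_le _ _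
    _ ≤ _ := by linarith [hI, hII]

end Cell


/-! ### Telescoping over a partition -/

section Partition

variable [MeasurableSpace C(ℝ≥0, ℝ)] [BorelSpace C(ℝ≥0, ℝ)]

/-- **Summing the cell estimates over a uniform partition of `[s, t]` into `N` cells of length `h`.**
[folklore] -/
theorem abs_setIntegral_sub_le_of_partition {s t : ℝ≥0} (hst : s ≤ t) {S : Set (ℝ≥0 → ℝ)}
    (hS : MeasurableSet[brownianFiltration s] S) {κ₀ : ℝ} (hκ₀ : 0 < κ₀) {N : ℕ} {h : ℝ≥0}
    (hhN : (N : ℝ≥0) * h = t - s) (hh0 : 0 < h)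
    (hh1 : (h : ℝ) ≤ (locLevel n * (locLevel n / 16) / 4000) ^ 2 / 32)
    (hh2 : stepSize κ₀ h ≤ locLevel n * (locLevel n / 16) / 1000)
    (hh3 : (h : ℝ) ≤ (locLevel n / 16 / 4) ^ 2)
    (hh4 : (h : ℝ) ≤ (κ₀ / stepSigma / 2) ^ 2 / 2) :
    |∫ ω in S, (locMart hA hne n t ω - locMart hA hne n s ω) ∂preWienerMeasure| ≤
      N * (stepC (locLevel n) (locLevel n / 16) * h * Real.sqrt h) + (2 * cellErr n κ₀ h) ^ (5 / 8 : ℝ) +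
        N * (128 * (h : ℝ) ^ 2 / (κ₀ / stepSigma) ^ 4) := by
  haveI := isProbabilityMeasure_preWienerMeasure'
  have hSm : MeasurableSet S := brownianFiltration.le s _ hS
  set T := locTime hA hne n with hT
  set u : ℕ → ℝ≥0 := fun i ↦ s + (i : ℝ≥0) * h with hu
  have hu0 : u 0 = s := by simp [hu]
  have huN : u N = t := by
    rw [hu]; simp only; rw [hhN, add_tsub_cancel_of_le hst]
  have husucc : ∀ i, u (i + 1) = u i + h := fun i ↦ by simp only [hu]; push_cast; ring
  have hsu : ∀ i, s ≤ u i := fun i ↦ by simp only [hu]; exact le_self_add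
  -- telescoping
  have hint : ∀ i, Integrable (locMart hA hne n (u i)) preWienerMeasure := fun i ↦ integrable_locMart _
  have htel : ∫ ω in S, (locMart hA hne n t ω - locMart hA hne n s ω) ∂preWienerMeasure =
      ∑ i ∈ Finset.range N, ∫ ω in S, (locMart hA hne n (u (i + 1)) ω - locMart hA hne n (u i) ω) ∂preWienerMeasure := by
    have e1 : (fun ω ↦ locMart hA hne n t ω - locMart hA hne n s ω) =
        fun ω ↦ ∑ i ∈ Finset.range N, (locMart hA hne n (u (i + 1)) ω - locMart hA hne n (u i) ω) := by
      funext ω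
      rw [Finset.sum_range_sub (fun i ↦ locMart hA hne n (u i) ω), huN, hu0]
    have hint' : ∀ i ∈ Finset.range N, Integrable (fun ω ↦ locMart hA hne n (u (i + 1)) ω - locMart hA hne n (u i) ω)
        (preWienerMeasure.restrict S) := fun i _ ↦ ((hint (i + 1)).sub (hint i)).integrableOn
    rw [e1]
    exact integral_finsetSum (Finset.range N) (f := fun i ω ↦ locMart hA hne n (u (i + 1)) ω - locMart hA hne n (u i) ω) hint'
  rw [htel]
  -- the events `{u_i < T < u_{i+1}}` are pairwise disjoint
  set E : ℕ → Set (ℝ≥0 → ℝ) := fun i ↦ {ω | ((u i : ℝ≥0) : WithTop ℝ≥0) < T ω ∧ T ω < ((u i + h : ℝ≥0) : WithTop ℝ≥0)} with hE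
  have hEm : ∀ i, MeasurableSet (E i) := fun i ↦ by
    obtain ⟨-, -, -, h1, h2⟩ := measurable_pieces (hA := hA) (hne := hne) (n := n) (u i) h
    exact h1.inter h2
  have hdisj : Set.PairwiseDisjoint (↑(Finset.range N) : Set ℕ) E := by
    intro i _ j _ hij
    rw [Function.onFun, Set.disjoint_left]
    rintro ω ⟨hi1, hi2⟩ ⟨hj1, hj2⟩
    have hh0' : (0 : ℝ) < h := hh0
    have hji : u j < u i + h := by
      have := hj1.trans hi2; exact_mod_cast this
    have hij' : u i < u j + h := by
      have := hi1.trans hj2; exact_mod_cast this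
    have hji_r : (s : ℝ) + j * h < s + i * h + h := by
      have := hji; simp only [hu] at this; exact_mod_cast this
    have hij_r : (s : ℝ) + i * h < s + j * h + h := by
      have := hij'; simp only [hu] at this; exact_mod_cast this
    rcases lt_or_gt_of_ne hij with hlt | hlt
    · have : (i : ℝ) + 1 ≤ j := by exact_mod_cast hlt
      nlinarith
    · have : (j : ℝ) + 1 ≤ i := by exact_mod_cast hlt
      nlinarith
  have hsumE : ∑ i ∈ Finset.range N, preWienerMeasure.real (E i) ≤ 1 := by
    have := sum_measureReal_le_measureReal_univ (μ := preWienerMeasure) (s := Finset.range N) (fun i _ ↦ hEm i) hdisj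
    rwa [probReal_univ] at this
  -- sum the cell estimates
  have hcell : ∀ i ∈ Finset.range N, |∫ ω in S, (locMart hA hne n (u (i + 1)) ω - locMart hA hne n (u i) ω) ∂preWienerMeasure| ≤
      stepC (locLevel n) (locLevel n / 16) * h * Real.sqrt h + (2 * cellErr n κ₀ h) ^ (5 / 8 : ℝ) * preWienerMeasure.real (E i) +
        128 * (h : ℝ) ^ 2 / (κ₀ / stepSigma) ^ 4 := fun i _ ↦ by
    rw [husucc]
    exact abs_setIntegral_cell_le (hsu i) hS hκ₀ hh0 hh1 hh2 hh3 hh4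
  have hD0 : 0 ≤ (2 * cellErr n κ₀ h) ^ (5 / 8 : ℝ) := by
    have : 0 ≤ cellErr n κ₀ h := by
      rw [cellErr]; have : 0 ≤ stepSize κ₀ h := by rw [stepSize]; positivity
      have := (locLevel_pos_le n).1; positivity
    exact Real.rpow_nonneg (by positivity) _
  calc |∑ i ∈ Finset.range N, ∫ ω in S, (locMart hA hne n (u (i + 1)) ω - locMart hA hne n (u i) ω) ∂preWienerMeasure|
      ≤ ∑ i ∈ Finset.range N, |∫ ω in S, (locMart hA hne n (u (i + 1)) ω - locMart hA hne n (u i) ω) ∂preWienerMeasure| :=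
        Finset.abs_sum_le_sum_abs _ _
    _ ≤ ∑ i ∈ Finset.range N, (stepC (locLevel n) (locLevel n / 16) * h * Real.sqrt h +
          (2 * cellErr n κ₀ h) ^ (5 / 8 : ℝ) * preWienerMeasure.real (E i) + 128 * (h : ℝ) ^ 2 / (κ₀ / stepSigma) ^ 4) :=
        Finset.sum_le_sum hcell
    _ = N * (stepC (locLevel n) (locLevel n / 16) * h * Real.sqrt h) +
          (2 * cellErr n κ₀ h) ^ (5 / 8 : ℝ) * ∑ i ∈ Finset.range N, preWienerMeasure.real (E i) +
          N * (128 * (h : ℝ) ^ 2 / (κ₀ / stepSigma) ^ 4) := by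
        rw [Finset.sum_add_distrib, Finset.sum_add_distrib, Finset.sum_const, Finset.sum_const, Finset.card_range,
          ← Finset.mul_sum]
        simp [nsmul_eq_mul]
    _ ≤ _ := by
        have := mul_le_mul_of_nonneg_left hsumE hD0
        linarith

/-! ### The increments of `Mⁿ` integrate to zero over `𝓕_s`-events -/

/-- **`∫_S (Mⁿ_t - Mⁿ_s) = 0` for `s ≤ t` and `S ∈ 𝓕_s`**: let the mesh of the partition go to `0`
(the sum of the cell bounds tends to `(4κ₀/ρ₀)^{5/8}`), then the oscillation threshold `κ₀ → 0`.
[cite: LawlerSchrammWerner2003Restriction, Prop. 5.2 and Prop. 5.3] -/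
theorem setIntegral_locMart_sub_eq_zero {s t : ℝ≥0} (hst : s ≤ t) {S : Set (ℝ≥0 → ℝ)}
    (hS : MeasurableSet[brownianFiltration s] S) :
    ∫ ω in S, (locMart hA hne n t ω - locMart hA hne n s ω) ∂preWienerMeasure = 0 := by
  rcases hst.eq_or_lt with heq | hst'
  · subst heq; simp
  obtain ⟨hc0, hc1⟩ := locLevel_pos_le n
  have hσ := stepSigma_pos
  set c := locLevel n with hc
  set ρ₀ : ℝ := c / 16 with hρ
  have hρ₀ : 0 < ρ₀ := by positivity
  set I : ℝ := ∫ ω in S, (locMart hA hne n t ω - locMart hA hne n s ω) ∂preWienerMeasure with hI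
  have hts : (0 : ℝ) < (t : ℝ) - s := by
    have : (s : ℝ) < t := by exact_mod_cast hst'
    linarith
  -- the mesh `h_N = (t - s)/(N + 1)` and its limits
  set hN : ℕ → ℝ≥0 := fun N ↦ (t - s) / ((N : ℝ≥0) + 1) with hhN
  have hhN' : ∀ N : ℕ, (((N + 1 : ℕ) : ℝ≥0)) * hN N = t - s := fun N ↦ by
    simp only [hhN]; push_cast
    rw [mul_div_cancel₀ _ (by positivity)]
  have hcoe : ∀ N : ℕ, (hN N : ℝ) = ((t : ℝ) - s) / ((N : ℝ) + 1) := fun N ↦ by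
    simp only [hhN]; push_cast [NNReal.coe_sub hst]; ring
  have hh_pos : ∀ N, 0 < hN N := fun N ↦ by
    have : (0 : ℝ) < hN N := by rw [hcoe]; positivity
    exact_mod_cast this
  have hh_tend : Tendsto (fun N ↦ (hN N : ℝ)) atTop (𝓝 0) := by
    simp_rw [hcoe]
    exact tendsto_const_nhds.div_atTop (tendsto_natCast_atTop_atTop.atTop_add tendsto_const_nhds)
  have hsqrt_tend : Tendsto (fun N ↦ Real.sqrt (hN N)) atTop (𝓝 0) := by
    have := (Real.continuous_sqrt.tendsto 0).comp hh_tend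
    rwa [Function.comp_def, Real.sqrt_zero] at this
  have hNh : ∀ N : ℕ, ((N + 1 : ℕ) : ℝ) * (hN N : ℝ) = (t : ℝ) - s := fun N ↦ by
    rw [hcoe]; push_cast; field_simp
  -- Step 1: for every small `κ₀ > 0`, `|I| ≤ (4κ₀/ρ₀)^{5/8}`
  have step1 : ∀ κ₀ : ℝ, 0 < κ₀ → κ₀ ≤ c * ρ₀ / 2000 → |I| ≤ (2 * (2 * κ₀ / ρ₀)) ^ (5 / 8 : ℝ) := by
    intro κ₀ hκ₀ hκc
    set RHS : ℕ → ℝ := fun N ↦ ((N + 1 : ℕ) : ℝ) * (stepC c ρ₀ * hN N * Real.sqrt (hN N)) +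
        (2 * cellErr n κ₀ (hN N)) ^ (5 / 8 : ℝ) + ((N + 1 : ℕ) : ℝ) * (128 * (hN N : ℝ) ^ 2 / (κ₀ / stepSigma) ^ 4) with hRHS
    have hRHS_eq : ∀ N, RHS N = stepC c ρ₀ * ((t : ℝ) - s) * Real.sqrt (hN N) + (2 * cellErr n κ₀ (hN N)) ^ (5 / 8 : ℝ) +
        128 * ((t : ℝ) - s) * (hN N : ℝ) / (κ₀ / stepSigma) ^ 4 := fun N ↦ by
      simp only [hRHS]
      have e := hNh N
      have e1 : ((N + 1 : ℕ) : ℝ) * (stepC c ρ₀ * hN N * Real.sqrt (hN N)) =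
          stepC c ρ₀ * (((N + 1 : ℕ) : ℝ) * hN N) * Real.sqrt (hN N) := by ring
      have e2 : ((N + 1 : ℕ) : ℝ) * (128 * (hN N : ℝ) ^ 2 / (κ₀ / stepSigma) ^ 4) =
          128 * (((N + 1 : ℕ) : ℝ) * hN N) * hN N / (κ₀ / stepSigma) ^ 4 := by ring
      rw [e1, e2, e]
    have hce : Tendsto (fun N ↦ cellErr n κ₀ (hN N)) atTop (𝓝 (50 * 0 / ρ₀ ^ 2 + 2 * (κ₀ + 4 * 0) / ρ₀)) := by
      have : (fun N ↦ cellErr n κ₀ (hN N)) = fun N ↦ 50 * (hN N : ℝ) / ρ₀ ^ 2 + 2 * (κ₀ + 4 * Real.sqrt (hN N)) / ρ₀ := by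
        funext N; rw [cellErr, stepSize]
      rw [this]
      exact ((tendsto_const_nhds.mul hh_tend).div_const _).add
        ((tendsto_const_nhds.mul (tendsto_const_nhds.add (tendsto_const_nhds.mul hsqrt_tend))).div_const _)
    have hlim : Tendsto RHS atTop (𝓝 ((2 * (2 * κ₀ / ρ₀)) ^ (5 / 8 : ℝ))) := by
      have h1 : Tendsto (fun N ↦ stepC c ρ₀ * ((t : ℝ) - s) * Real.sqrt (hN N)) atTop (𝓝 0) := by
        have := tendsto_const_nhds (x := stepC c ρ₀ * ((t : ℝ) - s)) |>.mul hsqrt_tend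
        rwa [mul_zero] at this
      have h2 : Tendsto (fun N ↦ (2 * cellErr n κ₀ (hN N)) ^ (5 / 8 : ℝ)) atTop (𝓝 ((2 * (2 * κ₀ / ρ₀)) ^ (5 / 8 : ℝ))) := by
        have := (tendsto_const_nhds (x := (2 : ℝ)) |>.mul hce).rpow_const (p := (5 / 8 : ℝ)) (Or.inr (by norm_num))
        convert this using 3; ring
      have h3 : Tendsto (fun N ↦ 128 * ((t : ℝ) - s) * (hN N : ℝ) / (κ₀ / stepSigma) ^ 4) atTop (𝓝 0) := by
        have := ((tendsto_const_nhds (x := 128 * ((t : ℝ) - s))).mul hh_tend).div_const ((κ₀ / stepSigma) ^ 4)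
        rwa [mul_zero, zero_div] at this
      have := (h1.add h2).add h3
      rw [zero_add, add_zero] at this
      exact this.congr fun N ↦ (hRHS_eq N).symm
    -- eventually all smallness conditions hold, and then `|I| ≤ RHS N`
    have hK1 : (0 : ℝ) < (c * ρ₀ / 4000) ^ 2 / 32 := by positivity
    have hK3 : (0 : ℝ) < (ρ₀ / 4) ^ 2 := by positivity
    have hK4 : (0 : ℝ) < (κ₀ / stepSigma / 2) ^ 2 / 2 := by positivity
    have hK2 : (0 : ℝ) < c * ρ₀ / 8000 := by positivity
    have hev : ∀ᶠ N in atTop, |I| ≤ RHS N := by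
      filter_upwards [hh_tend.eventually (eventually_le_nhds hK1), hh_tend.eventually (eventually_le_nhds hK3),
        hh_tend.eventually (eventually_le_nhds hK4), hsqrt_tend.eventually (eventually_le_nhds hK2)] with N h1 h3 h4 h2
      have hh2 : stepSize κ₀ (hN N) ≤ c * ρ₀ / 1000 := by rw [stepSize]; linarith
      have key := abs_setIntegral_sub_le_of_partition (hA := hA) (hne := hne) (n := n) hst hS hκ₀ (N := N + 1)
        (hhN' N) (hh_pos N) h1 hh2 h3 h4
      exact key
    exact ge_of_tendsto hlim hev
  -- Step 2: `κ₀ → 0`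
  have hL : Tendsto (fun κ₀ : ℝ ↦ (2 * (2 * κ₀ / ρ₀)) ^ (5 / 8 : ℝ)) (𝓝[>] 0) (𝓝 0) := by
    have h1 : Tendsto (fun κ₀ : ℝ ↦ 2 * (2 * κ₀ / ρ₀)) (𝓝 0) (𝓝 (2 * (2 * 0 / ρ₀))) :=
      ((continuous_const.mul ((continuous_const.mul continuous_id).div_const _)).tendsto 0)
    have h2 := h1.rpow_const (p := (5 / 8 : ℝ)) (Or.inr (by norm_num))
    rw [show 2 * (2 * (0 : ℝ) / ρ₀) = 0 by ring, Real.zero_rpow (by norm_num)] at h2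
    exact h2.mono_left nhdsWithin_le_nhds
  have hevκ : ∀ᶠ κ₀ in 𝓝[>] (0 : ℝ), |I| ≤ (2 * (2 * κ₀ / ρ₀)) ^ (5 / 8 : ℝ) := by
    have hpos : ∀ᶠ κ₀ in 𝓝[>] (0 : ℝ), 0 < κ₀ := eventually_mem_nhdsWithin
    have hsmall : ∀ᶠ κ₀ in 𝓝[>] (0 : ℝ), κ₀ ≤ c * ρ₀ / 2000 :=
      (eventually_le_nhds (by positivity : (0 : ℝ) < c * ρ₀ / 2000)).filter_mono nhdsWithin_le_nhds
    filter_upwards [hpos, hsmall] with κ₀ h1 h2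
    exact step1 κ₀ h1 h2
  have hI0 : |I| ≤ 0 := ge_of_tendsto hL hevκ
  exact abs_nonpos_iff.1 hI0

end Partition


/-! ### The martingale -/

/-- **[LSW] Prop. 5.2/5.3 (`κ = 8/3`), localised**: for every nonempty `*`-hull `A` and `n`, the
stopped process `Mⁿ_t = Φ'_{A_{t∧Tₙ} - W_{t∧Tₙ}}(0)^{5/8}` (`locMart`) is a bounded `𝓕`-martingale of the
SLE_{8/3} driving Brownian motion. [cite: LawlerSchrammWerner2003Restriction, Prop. 5.2 and Prop. 5.3] -/
theorem martingale_locMart : Martingale (locMart hA hne n) brownianFiltration preWienerMeasure := by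
  letI : MeasurableSpace C(ℝ≥0, ℝ) := borel _
  haveI : BorelSpace C(ℝ≥0, ℝ) := ⟨rfl⟩
  haveI := isProbabilityMeasure_preWienerMeasure'
  refine ⟨stronglyAdapted_locMart, fun i j hij ↦ ?_⟩
  have hm : brownianFiltration i ≤ (inferInstance : MeasurableSpace (ℝ≥0 → ℝ)) := brownianFiltration.le i
  haveI : IsFiniteMeasure (preWienerMeasure.trim hm) := isFiniteMeasure_trim hm
  refine (ae_eq_condExp_of_forall_setIntegral_eq hm (integrable_locMart j)
    (fun S _ _ ↦ (integrable_locMart i).integrableOn) (fun S hS _ ↦ ?_)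
    ((stronglyAdapted_locMart i).aestronglyMeasurable)).symm
  have h0 := setIntegral_locMart_sub_eq_zero (hA := hA) (hne := hne) (n := n) hij hS
  rw [integral_sub (integrable_locMart j).integrableOn (integrable_locMart i).integrableOn, sub_eq_zero] at h0
  exact h0.symm

end LocMart

end Literature.Probability.RandomPlanarGeometry
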